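import Summits.Ventures.PercRepro.SixFourResidueFourPlaneLineTWDefs

/-!
# PercRepro — C-025 at `(6,4)`: the TW-100 table at `t = 4`, `93 ≤ g ≤ 100` (p3, gen 11 — §21.18.7)

The per-`g` checks `minCheckAll g` (the minimiser `m*(g,q)` of `L(g,q,m)/C(m,2)` is a minimiser, integer form) and
`twCheckAll g` (the cell inequality `w′(g,n,e,s) ≥ 0` of Lemma TW with `μ = L(m*)/C(m*,2)`, integer form) for `93 ≤ g ≤ 100`,
by `decide +kernel`; see `SixFourResidueFourPlaneLineTWDefs.lean` for the definitions and the transfer lemmas.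
-/

namespace PercRepro.SixFour

set_option maxRecDepth 20000

/-- `minCheckAll 93` (by `decide +kernel`). -/
theorem minCheckAll_93 : minCheckAll 93 := by unfold minCheckAll; decide +kernel
/-- `twCheckAll 93` (by `decide +kernel`). -/
theorem twCheckAll_93 : twCheckAll 93 := by unfold twCheckAll; decide +kernel

/-- `minCheckAll 94` (by `decide +kernel`). -/
theorem minCheckAll_94 : minCheckAll 94 := by unfold minCheckAll; decide +kernel
/-- `twCheckAll 94` (by `decide +kernel`). -/
theorem twCheckAll_94 : twCheckAll 94 := by unfold twCheckAll; decide +kernel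

/-- `minCheckAll 95` (by `decide +kernel`). -/
theorem minCheckAll_95 : minCheckAll 95 := by unfold minCheckAll; decide +kernel
/-- `twCheckAll 95` (by `decide +kernel`). -/
theorem twCheckAll_95 : twCheckAll 95 := by unfold twCheckAll; decide +kernel

/-- `minCheckAll 96` (by `decide +kernel`). -/
theorem minCheckAll_96 : minCheckAll 96 := by unfold minCheckAll; decide +kernel
/-- `twCheckAll 96` (by `decide +kernel`). -/
theorem twCheckAll_96 : twCheckAll 96 := by unfold twCheckAll; decide +kernel

/-- `minCheckAll 97` (by `decide +kernel`). -/
theorem minCheckAll_97 : minCheckAll 97 := by unfold minCheckAll; decide +kernel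
/-- `twCheckAll 97` (by `decide +kernel`). -/
theorem twCheckAll_97 : twCheckAll 97 := by unfold twCheckAll; decide +kernel

/-- `minCheckAll 98` (by `decide +kernel`). -/
theorem minCheckAll_98 : minCheckAll 98 := by unfold minCheckAll; decide +kernel
/-- `twCheckAll 98` (by `decide +kernel`). -/
theorem twCheckAll_98 : twCheckAll 98 := by unfold twCheckAll; decide +kernel

/-- `minCheckAll 99` (by `decide +kernel`). -/
theorem minCheckAll_99 : minCheckAll 99 := by unfold minCheckAll; decide +kernel
/-- `twCheckAll 99` (by `decide +kernel`). -/
theorem twCheckAll_99 : twCheckAll 99 := by unfold twCheckAll; decide +kernel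

/-- `minCheckAll 100` (by `decide +kernel`). -/
theorem minCheckAll_100 : minCheckAll 100 := by unfold minCheckAll; decide +kernel
/-- `twCheckAll 100` (by `decide +kernel`). -/
theorem twCheckAll_100 : twCheckAll 100 := by unfold twCheckAll; decide +kernel

/-- `minCheckAll g` for every `93 ≤ g ≤ 100`. -/
theorem minCheckAll_of_rangeF {g : ℕ} (hg : 93 ≤ g) (hg' : g ≤ 100) : minCheckAll g := by
  interval_cases g
  exacts [minCheckAll_93, minCheckAll_94, minCheckAll_95, minCheckAll_96, minCheckAll_97, minCheckAll_98, minCheckAll_99, minCheckAll_100]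

/-- `twCheckAll g` for every `93 ≤ g ≤ 100`. -/
theorem twCheckAll_of_rangeF {g : ℕ} (hg : 93 ≤ g) (hg' : g ≤ 100) : twCheckAll g := by
  interval_cases g
  exacts [twCheckAll_93, twCheckAll_94, twCheckAll_95, twCheckAll_96, twCheckAll_97, twCheckAll_98, twCheckAll_99, twCheckAll_100]

end PercRepro.SixFour
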